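import Mathlib
import HarnessLib
import Literature.Analysis.SpecialFunctions.GammaMultiplication
import Literature.Analysis.SpecialFunctions.LemniscaticEllipticValuesProofs
import Summits.KontsevichZagierPeriods.KontsevichZagierPeriods.Theses.Neg

/-!
# KontsevichZagierPeriods / route Neg — value equality of the Gauss-triplication pair

Settles the support item stmt-KontsevichZagierPeriods-1030 (`TriplicationValueEq`) of route Neg:
for every integral representation `r` on the open unit square `(0,1)²` with integrand
`x^{-8/9}(1-x)^{-5/9} · y^{-4/9}(1-y)^{-2/9}` and every representation `r'` on the open disc
`{x² + y² < 4}` with the constant integrand `3^{7/6}/2`, the values agree: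

  `∫_{(0,1)²} x^{-8/9}(1-x)^{-5/9} y^{-4/9}(1-y)^{-2/9} dx dy = B(1/9,4/9)·B(5/9,7/9)
     = Γ(1/9)Γ(4/9)Γ(7/9)/Γ(4/3) = 2π·3^{7/6} = (3^{7/6}/2)·vol{x²+y²<4}`.

Proof (a theorem of Gauss, 1812): Tonelli on the square (`MeasureTheory.volume_pi`,
`MeasureTheory.Measure.restrict_pi_pi`, `MeasureTheory.integral_fintype_prod_eq_prod`), the two
real Beta integrals (`Literature.Analysis.SpecialFunctions.integral_Ioo_rpow_mul_one_sub_rpow`),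
Gauss's multiplication formula for `n = 3` at `x = 1/9` in its real form
(`Literature.Analysis.SpecialFunctions.GaussMultiplication.real_formula`), `Γ(4/3) = Γ(1/3)/3`
(`Real.Gamma_add_one`), and the area `4π` of the disc of radius `2` (`Complex.volume_ball`
transported along `Complex.volume_preserving_equiv_pi`).

Sources: C. F. Gauss, *Disquisitiones generales circa seriem infinitam* (1812);
G. E. Andrews, R. Askey, R. Roy, *Special Functions* (1999), Thm 1.5.2; NIST DLMF 5.5.6, 5.12.1;
M. Kontsevich, D. Zagier, *Periods* (2001), §1.1.
Deliberately NOT here: anything about KZ-equivalence of the pair (cruxes 0311 / 0312 of the route).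
-/

namespace Summit.KontsevichZagierPeriods.Neg

open MeasureTheory Set

/-- First Beta value: `∫_{(0,1)} u^{-8/9}(1-u)^{-5/9} du = B(1/9,4/9) = Γ(1/9)Γ(4/9)/Γ(5/9)`.
[folklore] -/
theorem neg_triplication_beta_one :
    ∫ u in Ioo (0:ℝ) 1, u ^ (-(8:ℝ)/9) * (1 - u) ^ (-(5:ℝ)/9) =
      Real.Gamma (1/9) * Real.Gamma (4/9) / Real.Gamma (5/9) := by
  have h := Literature.Analysis.SpecialFunctions.integral_Ioo_rpow_mul_one_sub_rpow
    (a := (1:ℝ)/9) (b := (4:ℝ)/9) (by norm_num) (by norm_num)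
  rw [show (1:ℝ)/9 - 1 = -(8:ℝ)/9 by norm_num, show (4:ℝ)/9 - 1 = -(5:ℝ)/9 by norm_num,
    show (1:ℝ)/9 + 4/9 = 5/9 by norm_num] at h
  exact h

/-- Second Beta value: `∫_{(0,1)} u^{-4/9}(1-u)^{-2/9} du = B(5/9,7/9) = Γ(5/9)Γ(7/9)/Γ(4/3)`.
[folklore] -/
theorem neg_triplication_beta_two :
    ∫ u in Ioo (0:ℝ) 1, u ^ (-(4:ℝ)/9) * (1 - u) ^ (-(2:ℝ)/9) =
      Real.Gamma (5/9) * Real.Gamma (7/9) / Real.Gamma (4/3) := by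
  have h := Literature.Analysis.SpecialFunctions.integral_Ioo_rpow_mul_one_sub_rpow
    (a := (5:ℝ)/9) (b := (7:ℝ)/9) (by norm_num) (by norm_num)
  rw [show (5:ℝ)/9 - 1 = -(4:ℝ)/9 by norm_num, show (7:ℝ)/9 - 1 = -(2:ℝ)/9 by norm_num,
    show (5:ℝ)/9 + 7/9 = 4/3 by norm_num] at h
  exact h

/-- Tonelli on the open unit square: the value of any representation `r` with domain `(0,1)²` and
the product integrand `x^{-8/9}(1-x)^{-5/9} · y^{-4/9}(1-y)^{-2/9}` is the product of the two
one-dimensional Beta integrals. [folklore] -/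
theorem neg_triplication_value_square
    (r : Literature.NumberTheory.Transcendental.KZ.IntegralRep 2)
    (hd : r.domain = {x | ∀ i, x i ∈ Set.Ioo (0:ℝ) 1})
    (hf : Set.EqOn r.integrand (fun x => (x 0) ^ (-(8:ℝ)/9) * (1 - x 0) ^ (-(5:ℝ)/9) *
      (x 1) ^ (-(4:ℝ)/9) * (1 - x 1) ^ (-(2:ℝ)/9)) r.domain) :
    r.value = (∫ u in Ioo (0:ℝ) 1, u ^ (-(8:ℝ)/9) * (1 - u) ^ (-(5:ℝ)/9)) *
      (∫ u in Ioo (0:ℝ) 1, u ^ (-(4:ℝ)/9) * (1 - u) ^ (-(2:ℝ)/9)) := by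
  unfold Literature.NumberTheory.Transcendental.KZ.IntegralRep.value
  have hS : ({x | ∀ i, x i ∈ Set.Ioo (0:ℝ) 1} : Set (Fin 2 → ℝ)) =
      Set.pi Set.univ (fun _ => Set.Ioo (0:ℝ) 1) := by
    ext x
    simp
  have hm : MeasurableSet r.domain := by
    rw [hd, hS]
    exact MeasurableSet.univ_pi (fun _ => measurableSet_Ioo)
  rw [setIntegral_congr_fun hm hf, hd, hS, volume_pi, Measure.restrict_pi_pi]
  have hprod : (fun x : Fin 2 → ℝ => (x 0) ^ (-(8:ℝ)/9) * (1 - x 0) ^ (-(5:ℝ)/9) *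
      (x 1) ^ (-(4:ℝ)/9) * (1 - x 1) ^ (-(2:ℝ)/9)) =
      fun x => ∏ i, (![fun u : ℝ => u ^ (-(8:ℝ)/9) * (1 - u) ^ (-(5:ℝ)/9),
        fun u : ℝ => u ^ (-(4:ℝ)/9) * (1 - u) ^ (-(2:ℝ)/9)] i) (x i) := by
    funext x
    rw [Fin.prod_univ_two]
    simp only [Matrix.cons_val_zero, Matrix.cons_val_one]
    ring
  rw [hprod, integral_fintype_prod_eq_prod, Fin.prod_univ_two]
  simp only [Matrix.cons_val_zero, Matrix.cons_val_one]

/-- Area of the open disc of radius `2` in `Fin 2 → ℝ`: `vol {x 0² + x 1² < 4} = 4π`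
(Mathlib's `Complex.volume_ball` transported along `Complex.measurableEquivPi`). [folklore] -/
theorem neg_triplication_volume_disc :
    volume ({x | x 0 ^ 2 + x 1 ^ 2 < 4} : Set (Fin 2 → ℝ)) = ENNReal.ofReal (4 * Real.pi) := by
  have hm : MeasurableSet ({x | x 0 ^ 2 + x 1 ^ 2 < 4} : Set (Fin 2 → ℝ)) := by
    refine (isOpen_lt ?_ continuous_const).measurableSet
    fun_prop
  have hpre : Complex.measurableEquivPi ⁻¹' ({x | x 0 ^ 2 + x 1 ^ 2 < 4} : Set (Fin 2 → ℝ)) =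
      Metric.ball (0 : ℂ) 2 := by
    ext a
    rw [mem_preimage, mem_setOf_eq, Complex.measurableEquivPi_apply, mem_ball_zero_iff]
    simp only [Matrix.cons_val_zero, Matrix.cons_val_one]
    have h : a.re ^ 2 + a.im ^ 2 = ‖a‖ ^ 2 := by
      rw [Complex.sq_norm, Complex.normSq_apply]
      ring
    rw [h, show (4:ℝ) = 2 ^ 2 by norm_num]
    exact pow_lt_pow_iff_left₀ (norm_nonneg a) (by norm_num) two_ne_zero
  rw [← Complex.volume_preserving_equiv_pi.measure_preimage hm.nullMeasurableSet, hpre,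
    Complex.volume_ball, ← ENNReal.ofReal_pow (by norm_num : (0:ℝ) ≤ 2),
    ENNReal.ofReal_mul (by norm_num : (0:ℝ) ≤ 4), ← NNReal.coe_real_pi, ENNReal.ofReal_coe_nnreal]
  norm_num

/-- The value of any representation `r'` with domain the open disc `{x² + y² < 4}` and constant
integrand `3^{7/6}/2` is `4π · 3^{7/6}/2`. [folklore] -/
theorem neg_triplication_value_disc
    (r' : Literature.NumberTheory.Transcendental.KZ.IntegralRep 2)
    (hd' : r'.domain = {x | x 0 ^ 2 + x 1 ^ 2 < 4})
    (hf' : Set.EqOn r'.integrand (fun _ => (3:ℝ) ^ ((7:ℝ)/6) / 2) r'.domain) :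
    r'.value = 4 * Real.pi * ((3:ℝ) ^ ((7:ℝ)/6) / 2) := by
  unfold Literature.NumberTheory.Transcendental.KZ.IntegralRep.value
  have hm : MeasurableSet ({x | x 0 ^ 2 + x 1 ^ 2 < 4} : Set (Fin 2 → ℝ)) := by
    refine (isOpen_lt ?_ continuous_const).measurableSet
    fun_prop
  have hm' : MeasurableSet r'.domain := hd' ▸ hm
  rw [setIntegral_congr_fun hm' hf', hd', setIntegral_const, measureReal_def,
    neg_triplication_volume_disc, ENNReal.toReal_ofReal (by positivity), smul_eq_mul]

/-- **Gauss triplication at `1/9`, Beta form**: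
`B(1/9,4/9) · B(5/9,7/9) = Γ(1/9)Γ(4/9)Γ(7/9)/Γ(4/3) = 2π·3^{7/6} = 4π · 3^{7/6}/2`, from the
multiplication formula `Γ(1/9)Γ(4/9)Γ(7/9)·3^{1/3} = Γ(1/3)·√3·2π` and `Γ(4/3) = Γ(1/3)/3`.
[cite: AndrewsAskeyRoy1999, Thm 1.5.2] -/
theorem neg_triplication_gamma_identity :
    Real.Gamma (1/9) * Real.Gamma (4/9) / Real.Gamma (5/9) *
        (Real.Gamma (5/9) * Real.Gamma (7/9) / Real.Gamma (4/3)) =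
      4 * Real.pi * ((3:ℝ) ^ ((7:ℝ)/6) / 2) := by
  -- Gauss multiplication, n = 3, x = 1/9 (real form, proved in the tree)
  have hG : Real.Gamma (1/9) * Real.Gamma (4/9) * Real.Gamma (7/9) * (3:ℝ) ^ ((1:ℝ)/3) =
      Real.Gamma (1/3) * Real.sqrt 3 * (2 * Real.pi) := by
    have h := Literature.Analysis.SpecialFunctions.GaussMultiplication.real_formula
      (n := 3) (by norm_num) (x := (1:ℝ)/9) (by norm_num)
    norm_num [Literature.Analysis.SpecialFunctions.GaussMultiplication.prodGamma,
      Finset.prod_range_succ] at h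
    exact h
  -- Γ(4/3) = Γ(1/3)/3
  have h43 : Real.Gamma (4/3) = 1/3 * Real.Gamma (1/3) := by
    have h := Real.Gamma_add_one (s := (1:ℝ)/3) (by norm_num)
    rw [show (1:ℝ)/3 + 1 = 4/3 by norm_num] at h
    rw [h]
  -- all powers of 3 through t = 3^{1/6}
  set t : ℝ := (3:ℝ) ^ ((1:ℝ)/6) with ht
  have ht0 : 0 < t := Real.rpow_pos_of_pos (by norm_num) _
  have hk : ∀ k : ℕ, t ^ k = (3:ℝ) ^ ((k:ℝ)/6) := fun k => by
    rw [ht, ← Real.rpow_natCast, ← Real.rpow_mul (by norm_num : (0:ℝ) ≤ 3)]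
    congr 1
    ring
  have ht2 : (3:ℝ) ^ ((1:ℝ)/3) = t ^ 2 := by rw [hk]; norm_num
  have ht3 : Real.sqrt 3 = t ^ 3 := by rw [hk, Real.sqrt_eq_rpow]; norm_num
  have ht6 : t ^ 6 = 3 := by rw [hk]; norm_num
  have ht7 : (3:ℝ) ^ ((7:ℝ)/6) = t ^ 7 := by rw [hk]; norm_num
  rw [ht2, ht3] at hG
  have hP : Real.Gamma (1/9) * Real.Gamma (4/9) * Real.Gamma (7/9) =
      2 * Real.pi * Real.Gamma (1/3) * t := by
    have ht2' : t ^ 2 ≠ 0 := by positivity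
    apply mul_right_cancel₀ ht2'
    rw [hG]
    ring
  have hΓ5 : Real.Gamma (5/9) ≠ 0 := (Real.Gamma_pos_of_pos (by norm_num)).ne'
  have hΓ3 : Real.Gamma (1/3) ≠ 0 := (Real.Gamma_pos_of_pos (by norm_num)).ne'
  rw [ht7, h43, div_mul_div_comm, div_eq_iff (by positivity)]
  linear_combination Real.Gamma (5/9) * hP -
    (2/3 * Real.pi * t * Real.Gamma (5/9) * Real.Gamma (1/3)) * ht6

/-- **Settles stmt-KontsevichZagierPeriods-1030** (route Neg, support `TriplicationValueEq`): the
Gauss-triplication pair has equal values,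
`∫_{(0,1)²} x^{-8/9}(1-x)^{-5/9} y^{-4/9}(1-y)^{-2/9} = 2π·3^{7/6} = (3^{7/6}/2)·vol{x²+y²<4}`.
[cite: AndrewsAskeyRoy1999, Thm 1.5.2] -/
theorem triplicationValueEq_proof :
    Summit.KontsevichZagierPeriods.KontsevichZagierPeriods.Theses.Neg.TriplicationValueEq := by
  unfold Summit.KontsevichZagierPeriods.KontsevichZagierPeriods.Theses.Neg.TriplicationValueEq
  intro r r' hd hf hd' hf'
  rw [neg_triplication_value_square r hd hf, neg_triplication_value_disc r' hd' hf',
    neg_triplication_beta_one, neg_triplication_beta_two]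
  exact neg_triplication_gamma_identity

end Summit.KontsevichZagierPeriods.Neg
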